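import Literature.MathematicalPhysics.QuantumFieldTheory.Balaban1983to89.B9Delta2FormMajorant
import Literature.MathematicalPhysics.QuantumFieldTheory.Balaban1983to89.B9Ineq347AllEntries

/-!
# `Balaban1983to89.B9Eq3136HstarJBound` — [B9] p. 422, the sentence between (3.136) and (3.137): *"From the regularity condition (3.36) and the
# inequality (3.133) we have the estimate |(H\*J)(b)| ≦ O(1)Mα₀(Lʲη)⁻³ for b ∈ Λ_j"* — AS A THEOREM of a COLUMN-BLOCK letter for `H(U)` (the row
# majorant of ANY counting-transpose of the H-letter's coordinate model `HcoK`), r06's bond-local regularity datum `RegularAt` at every fine bond, and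
# ONE scale transfer + ONE row sum of [4] Lemma 2.1

T. Bałaban, *Propagators for lattice gauge theories in a background field*, Commun. Math. Phys. **99** (1985) 389–434 [`Balaban1985BackgroundPropagators`,
"B9"]; [4] = T. Bałaban, *Propagators and renormalization transformations for lattice gauge theories. II*, Commun. Math. Phys. **96** (1984) 223–250
[`Balaban1984PropagatorsII`].  statement-level skeleton of published theorems with citation tags; proofs where landed; nothing here is a claim about the
Yang–Mills mass gap.

THE PRINT (p. 422).  (3.136) writes `Δ⁽²⁾A` against `(H\*J)(b)`, `b ∈ Λ_j` a coarse bond, `H = GQ\*(QGQ\*)⁻¹` of (3.126), `J` the current of (3.117); the next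
sentence bounds `(H\*J)(b)` by `O(1)Mα₀(Lʲη)⁻³` *"from the regularity condition (3.36) and the inequality (3.133)"*: (3.36) gives `|J(x)| ≦ O(1)Mα₀(L^{j(x)}η)⁻³`
pointwise (r06 `B9Eq336CurrentBound.norm_J_le_blocks` under the bond-local datum `RegularAt`), and (3.133) — the [4]-(2.51) majorant of the kernel of `H`
— makes the sum over the fine bonds `x` of `|H(x, b)|` weighted by the blocks an «O(1)» geometric sum (the p. 398 scale transfer + (2.61)).

THE POINT (seat n06-w8's LOCATED-(B′), cell bus I.34857; WIDTH-209 N06).  n06-w8 g2's `B9Delta2FormMajorant` (F5) + `…N06Delta2AtPinsC2Phys` (F6) derive the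
N06 certificate's (3.137) letters `hD2sup ∕ hD2L2` from [5] (149) and a DISPLAYED `(H\*J)` letter `hHJ : ‖(H(U)†J(U))(c)‖ ≦ t·Mα₀·w_H(c)` (`H† = trAdjY`, def-Y's
`τ`-transpose).  THIS FILE proves that letter.  The one subtlety is the SUM OVER A FINE BLOCK of `|H(x, b)|` (print pays it with the `η^d` of the weighted
scalar product against the `(L^{j′}η)^{−d}` of (3.133)): in the tree's unweighted currency it is a COLUMN block sum of the H-letter's coordinate model
`HcoK` (n06-d `B9CoReadingCoordsH`), i.e. a ROW block sum — a [4]-(2.51) `HasMajorantHom` — of ANY counting-transpose `T′` of that model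
(`B9Thm37Glue.IsTransposePair (HcoK …) T′`; the certificate's dictionary `B9CoReadingCoordsTranspose` turns `τ`-adjoint letter families into such pairs).
So the inputs are: the transpose-majorant letter (DISPLAYED by the consumer; (3.133)'s content in column form), `RegularAt` at every fine bond at the scale
of its block (DISPLAYED by the consumer; (3.36) — the cube covering of the fine bonds by the class cubes is the W-b road), one `ScaleTransfer` at the
exponent `−3` and one row sum (member facts at the pins).
* §1 ★ `sum_fiber_abs_apply_le_of_transposePair` — real linear algebra: column block sums of `A` from a row block majorant of a transpose `A′`
  (`Σ_{x ∈ Δ(y′)} |(Av)(x)| ≦ Σ_j |v_j|·K′(blk j, y′)`, the sign test vector on the block);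
* §2 at an index, for an H-letter `O(U) : (coarse → 𝔸) →ₗ (fine → 𝔸)` (`𝔸` any fibre with a real basis `b`): `sum_abs_evDiagK_indY_le` (the `ℓ¹` size
  `≦ (d+1)·#κ` of the diagonal evaluation of the indicator of a coarse point), `norm_apply_deltaY_le_sum_basis` (the pointwise kernel letter in a general
  direction `a` from the basis directions: `K_H(z) := coordBound39 b·Σ_{k′} ‖O(U)(δ_c ⊗ b_{k′})(z)‖`), ★★ `sum_fiber_kernel_le_of_transposePair`
  (`IsTransposePair (HcoK i b B cfg O U₁) T′` + `HasMajorantHom (σ∘fst) (σI∘fst) T′ K′` ⟹ the COLUMN-BLOCK SUMS `Σ_{z : σ z = y′} K_H(z) ≦ (d+1)·#κ·K′(σ_I c, y′)`,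
  constant kept unreduced; `colConst_eq` reduces it: `coordBound·#κ·basisBound = cR39`), ★★ `sum_fiber_norm_apply_deltaY_le_of_transposePair` (the
  column-block kernel letter `Σ_{z : σ z = y′} ‖O(U)(δ_c ⊗ a)(z)‖ ≦ (d+1)·#κ·K′(σ_I c, y′)·‖a‖` — the SUM-OVER-THE-BLOCK twin of F5 §5's pointwise
  `norm_apply_deltaY_le_of_hasMajorantHom`);
* §3 `sum_mul_weight_fiberwise_le` (regrouping a fine sum by blocks under a column-block letter), ★★ `norm_trAdjY_apply_le_cols` — `‖(H†J)(c)‖ ≦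
  N·𝔟²·t_J·Σ_{y′} k(y′)·w_J(y′)` for ANY `ℂ`-linear `H` with the pointwise kernel letter `‖H(δ_c⊗a)(z)‖ ≦ K_H(z)‖a‖`, column-block sums `Σ_{z∈Δ(y′)} K_H(z) ≦ k(y′)`
  and `‖J(z)‖ ≦ t_J·w_J(σ z)` (F5 §4 `norm_trAdjY_apply_le` + the regrouping);
* §4 ★ `sum_exp_mul_weight_le` — the «O(1)» sum: `Σ_{y′} e^{−δ d(c,y′)}·W(y′) ≦ C_T·c_R·W(c)` from a DISPLAYED transfer of `W` at rate `ρ_T`, a row sum at rate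
  `ρ_R`, `ρ_T + ρ_R ≦ δ`; ★ `scaleTransfer_len_rpow_of_size` — the p. 398 transfer of `(Lʲη)^γ` at ANY exponent `γ` under the explicit size condition
  `|γ|·log L ≦ αδRM` (F5's `B9RWSums346Schur.scaleTransfer_len_rpow` has `|γ| ≦ 4` hard-wired through `Facts347.size`; same engine `B9Ineq347.scaleTransfer_of_260`);
* §5 ★★★ `norm_trAdjY_JY_le_of_cols_regularAt` — THE PRINTED SENTENCE for def-Y's genuine current `J(U) = JY i U` and ANY `ℂ`-linear `H` (e.g. def-Y's
  `HDY i parS parB Gp U` at any site propagator `Gp`): the pointwise∕column-block kernel letters for `H` with `k(y′) = B_H·e^{−δ_H d(σ_I c, y′)}`, `RegularAt`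
  at every fine bond at the scale `len (σ_I (bI ⟨s, 0⟩))` of the block its source is pinned to (direction-blind pin `hbI0`), constant `0 ≦ C ≦ 1`, the
  transfer of `(len)⁻³` and the row sum ⟹ `‖(H†J(U))(c)‖ ≦ N·𝔟²·(10⁴(d+1)C)·B_H·C_T·c_R·(len (σ_I c))⁻³` — print's `O(1)Mα₀(Lʲη)⁻³` with `C = O(1)Mα₀`;
  ★★★ `norm_trAdjY_JY_le_of_transposePair_regularAt` — the same from the TRANSPOSE MAJORANT `B_T·e^{−δ_T d}` of the model of `O(U)` (§2 ∘ §5; `B_H =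
  (d+1)·#κ·B_T`, `κ = TrIdx N`).
* §6 (v1.1, APPEND-ONLY) ★★★ `norm_trAdjY_JY_le_of_transposePair_regularAt_w` — the same with a WEIGHT `W_T(a)` at the coarse end of the transpose
  majorant (`B_T·W_T(a)·e^{−δ_T d}`): the member-uniformly inhabitable form at the N06 record (`W_T = n_c`, the block count, from the flat `C ≍ n·(Lʲη)⁻²`;
  §5's one-call form is `W_T ≡ 1`); the weight travels into `w_H(c) = W_T(c)·(Lʲη)_c⁻³` — print's volume factor between `H†` and `H\*`.
HONEST SCOPE.  Finite-dimensional bookkeeping (signs, fibres, [4] (2.51)∕(2.54)∕(2.60)∕(2.61)) over r06's (3.36) theorem BY NAME; (3.133) is NOT proved here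
(the transpose-majorant letter is a hypothesis of printed shape), the covering of every fine bond by a class cube of (3.35)–(3.36) is NOT proved here
(`RegularAt` everywhere is a hypothesis; at level-0 bonds the class `cubeClass396` has no cube — the located W-b gap); count-neutral; N06 NOT discharged; one
finite lattice at a time — nothing continuum ∕ ℝ⁴ ∕ OS ∕ mass gap ∕ Clay.  Cell `pub-ymgap` (HUMAN RULING D-0062), Track A node N06 [B9], seat
`pub-ymgap-dag-n06-w8` (g2′), 2026-08-28.  NEW file; relatives not restated: F5 `B9Delta2FormMajorant` §4–§5 (consumed BY NAME), n06-d `B9CoReadingCoordsH`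
(`HcoK`), r06 `B9Eq336CurrentBound`, p21∕n06-k member facts (consumed at the pins, not here).
-/

noncomputable section

namespace Literature.MathematicalPhysics.QuantumFieldTheory.Balaban1983to89.B9Eq3136HstarJBound

open Node00 (trDualMatY trAdjY JY CfgY FBondY IBondY SiteParY BondParY SiteOpY deltaY liftY liftY_apply etaBY)
open B6KLevelCensusIndexV1 (KIdx)
open B9Thm37Glue (IsTransposePair)
open B6RandomWalk (BlockSupp)
open B6RandomWalkHom (HasMajorantHom)
open B9Thm34Ext (toB6)
open B9CoReadingCoords (XBK evDiagK abs_evDiagK_le evDiagK_eq_zero_of norm_le_basisBound_mul)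
open B9CoReadingCoordsH (XHK HcoK indY liftY_indY abs_indY_le indY_of_ne coordOpKH_evDiagK)
open B9Thm39ReadingCoords (cR39 basisBound39 coordBound39 abs_repr_le cR39_nonneg)
open B9CoReadingCoordsTranspose (TrIdx trBasis)
open B9Delta2FormMajorant (norm_trAdjY_apply_le norm_JY_le_of_regularAt etaBY_pos)
open B9Ineq347 (ScaleTransfer scaleTransfer_of_260)
open B9Ineq347AllEntries (rpow_abs_mul_exp_le_one weight_ratio weight_nonneg h260_nat_of_Ineq260)
open B6RandomWalk (Ineq260)
open scoped Matrix
open scoped Matrix.Norms.L2Operator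

/-! ## §1 Column block sums from a row block majorant of a transpose -/

section Transpose

variable {G : B6.Geometry} {X Y : Type} [Fintype X] [Fintype Y]

open Classical in
/-- ★ **COLUMN BLOCK SUMS OF `A` FROM A ROW BLOCK MAJORANT OF A TRANSPOSE `A′`**: if `Σ_x (Au)(x)v(x) = Σ_j u(j)(A′v)(j)` (`IsTransposePair A A′` for
the counting pairings) and `A′` has the [4]-(2.51) two-space majorant `K′` (`|(A′μ)(j)| ≦ K′(blk j, y′)·|μ|` for `supp μ ⊂ Δ(y′)`), then for every input
`v` and every block `y′` of the output carrier `Σ_{x ∈ Δ(y′)} |(Av)(x)| ≦ Σ_j |v(j)|·K′(blk j, y′)` — test `A v` against the sign vector of the block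
(block fibres with classical decidability). [cite: Balaban1984PropagatorsII, (2.51) p.232; folklore] -/
theorem sum_fiber_abs_apply_le_of_transposePair (A : (Y → ℝ) →ₗ[ℝ] (X → ℝ)) (A' : (X → ℝ) →ₗ[ℝ] (Y → ℝ))
    (hT : IsTransposePair A A') (blkX : X → G.Site) (blkY : Y → G.Site) {K' : G.Site → G.Site → ℝ}
    (hK' : HasMajorantHom blkX blkY A' K') (v : Y → ℝ) (y' : G.Site) :
    ∑ x ∈ Finset.univ.filter (fun x => blkX x = y'), |A v x| ≤ ∑ j, |v j| * K' (blkY j) y' := by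
  classical
  -- the sign test vector of `A v` on the block `y′`
  set s : X → ℝ := fun x => if blkX x = y' then (if 0 ≤ A v x then 1 else -1) else 0 with hs
  have hsupp : BlockSupp blkX s y' 1 := by
    refine ⟨zero_le_one, fun x hx => ?_, fun x hx => ?_⟩
    · simp only [hs, if_pos hx]; split_ifs <;> simp
    · simp only [hs, if_neg hx]
  have hsum : ∑ x ∈ Finset.univ.filter (fun x => blkX x = y'), |A v x| = ∑ x, A v x * s x := by
    rw [← Finset.sum_filter_add_sum_filter_not Finset.univ (fun x => blkX x = y') (fun x => A v x * s x)]
    have h0 : ∑ x ∈ Finset.univ.filter (fun x => ¬ blkX x = y'), A v x * s x = 0 :=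
      Finset.sum_eq_zero fun x hx => by simp only [hs, if_neg (Finset.mem_filter.1 hx).2, mul_zero]
    rw [h0, add_zero]
    refine Finset.sum_congr rfl fun x hx => ?_
    have hxy : blkX x = y' := (Finset.mem_filter.1 hx).2
    simp only [hs, if_pos hxy]
    split_ifs with h
    · rw [mul_one, abs_of_nonneg h]
    · rw [mul_neg, mul_one, abs_of_neg (lt_of_not_ge h)]
  rw [hsum, hT v s]
  calc ∑ j, v j * A' s j ≤ ∑ j, |v j * A' s j| := Finset.sum_le_sum fun j _ => le_abs_self _
    _ = ∑ j, |v j| * |A' s j| := Finset.sum_congr rfl fun j _ => abs_mul _ _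
    _ ≤ ∑ j, |v j| * K' (blkY j) y' := Finset.sum_le_sum fun j _ =>
        mul_le_mul_of_nonneg_left (by simpa using hK' y' s 1 hsupp j) (abs_nonneg _)

end Transpose

/-! ## §2 At an index: the column-block kernel letter of an H-letter from a transpose majorant of its coordinate model `HcoK` -/

section Column

variable {d ℓ : ℕ} {hd : 1 ≤ d + 1} {hL : Odd (ℓ + 1) ∧ 1 < ℓ + 1} {b₀ b₁ : ℝ}
variable {𝔸 : Type} [NormedRing 𝔸] [NormedAlgebra ℂ 𝔸] [CompleteSpace 𝔸] [FiniteDimensional ℝ 𝔸]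
variable {κ : Type} [Fintype κ] [DecidableEq κ]
variable (i : KIdx d ℓ hd hL b₀ b₁) (b : Module.Basis κ ℝ 𝔸) (B : B9.Backgrounds) (cfg : B.Cfg → CfgY 𝔸 i)
  (O : CfgY 𝔸 i → (IBondY i → 𝔸) →ₗ[ℂ] (FBondY i → 𝔸))
variable {g : B9.Geometry} [Fintype g.Site] {R₀ : ℝ} {H₀ : Prop}

/-- the `ℓ¹` size of the diagonal evaluation of the indicator of a coarse point: at most `(d+1)·#κ` entries of modulus `≦ 1`.
[cite: Balaban1985BackgroundPropagators, (3.133) p.422, bookkeeping] -/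
theorem sum_abs_evDiagK_indY_le (c : IBondY i) :
    ∑ p : XHK κ i, |evDiagK (κ := κ) (D := Fin (d + 1)) (indY i c) p| ≤ (d + 1) * Fintype.card κ := by
  classical
  have hpt : ∀ p : XHK κ i, |evDiagK (κ := κ) (D := Fin (d + 1)) (indY i c) p| ≤
      if p.1 = c ∧ p.2.2.1 = p.2.2.2 then 1 else 0 := by
    intro p
    by_cases h1 : p.1 = c
    · by_cases h2 : p.2.2.1 = p.2.2.2
      · rw [if_pos ⟨h1, h2⟩]; exact (abs_evDiagK_le _ p).trans (abs_indY_le i c p.1)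
      · have : evDiagK (κ := κ) (D := Fin (d + 1)) (indY i c) p = 0 := by unfold evDiagK; rw [if_neg h2]
        rw [this, abs_zero]; split_ifs <;> norm_num
    · rw [evDiagK_eq_zero_of (indY_of_ne i h1), abs_zero]; split_ifs <;> norm_num
  refine (Finset.sum_le_sum fun p _ => hpt p).trans ?_
  rw [Finset.sum_boole]
  -- the set `{(c, ν, k, k)}` has `(d+1)·#κ` elements: it is the image of `ν, k ↦ (c, ν, k, k)`
  have hcard : (Finset.univ.filter fun p : XHK κ i => p.1 = c ∧ p.2.2.1 = p.2.2.2) =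
      (Finset.univ : Finset (Fin (d + 1) × κ)).image fun q => (c, q.1, q.2, q.2) := by
    ext p
    simp only [Finset.mem_filter, Finset.mem_univ, true_and, Finset.mem_image]
    constructor
    · rintro ⟨h1, h2⟩
      refine ⟨(p.2.1, p.2.2.1), ?_⟩
      rcases p with ⟨p1, p2, p3, p4⟩
      simp only at h1 h2 ⊢
      rw [h1, h2]
    · rintro ⟨q, rfl⟩; exact ⟨rfl, rfl⟩
  rw [hcard]
  have hle : ((Finset.univ : Finset (Fin (d + 1) × κ)).image fun q => ((c, q.1, q.2, q.2) : XHK κ i)).card ≤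
      (Finset.univ : Finset (Fin (d + 1) × κ)).card := Finset.card_image_le
  rw [Finset.card_univ, Fintype.card_prod, Fintype.card_fin] at hle
  exact_mod_cast hle

omit [DecidableEq κ] in
/-- the kernel letter of an H-letter in a general fibre direction from the basis directions: `‖O(U)(δ_c ⊗ a)(z)‖ ≦ coordBound39 b·(Σ_{k′} ‖O(U)(δ_c ⊗ b_{k′})(z)‖)·‖a‖`
(expand `a` in the real basis `b`; `|a_{k′}| ≦ coordBound39 b·‖a‖`). [cite: Balaban1985BackgroundPropagators, (3.133) p.422, (3.126) p.420, bookkeeping] -/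
theorem norm_apply_deltaY_le_sum_basis (U : CfgY 𝔸 i) (a : 𝔸) (c : IBondY i) (z : FBondY i) :
    ‖O U (deltaY c a) z‖ ≤ (coordBound39 b * ∑ k', ‖O U (deltaY c (b k')) z‖) * ‖a‖ := by
  have hdec : (deltaY c a : IBondY i → 𝔸) = ∑ k', ((b.repr a k' : ℝ) : ℂ) • deltaY c (b k') := by
    funext w
    rw [Finset.sum_apply]
    simp only [deltaY, Pi.smul_apply]
    split_ifs
    · conv_lhs => rw [← b.sum_repr a]
      refine Finset.sum_congr rfl fun k' _ => ?_
      rw [Complex.coe_smul]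
    · simp
  rw [hdec, map_sum, Finset.sum_apply]
  refine (norm_sum_le _ _).trans ?_
  rw [mul_assoc, Finset.sum_mul, Finset.mul_sum]
  refine Finset.sum_le_sum fun k' _ => ?_
  rw [map_smul, Pi.smul_apply, norm_smul, Complex.norm_real, Real.norm_eq_abs]
  calc |b.repr a k'| * ‖O U (deltaY c (b k')) z‖ ≤ coordBound39 b * ‖a‖ * ‖O U (deltaY c (b k')) z‖ :=
        mul_le_mul_of_nonneg_right (abs_repr_le b a k') (norm_nonneg _)
    _ = coordBound39 b * (‖O U (deltaY c (b k')) z‖ * ‖a‖) := by ring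

open Classical in
/-- ★★ **THE COLUMN-BLOCK SUMS OF THE BASIS-DIRECTION KERNELS FROM A TRANSPOSE MAJORANT** (the heart of `sum_fiber_norm_apply_deltaY_le_of_transposePair`, stated
for the pointwise kernel `K_H(z) := coordBound39 b·Σ_{k′} ‖O(U)(δ_c ⊗ b_{k′})(z)‖` of `norm_apply_deltaY_le_sum_basis`): `Σ_{z : σ z = y′} K_H(z) ≦
(coordBound39 b·#κ)·(basisBound39 b·((cR39 b)⁻¹·((d+1)·#κ·K′(σ_I c, y′))))` — the shape §3 ∕ §5 consume.
[cite: Balaban1985BackgroundPropagators, (3.133) p.422, (3.136) p.422; Balaban1984PropagatorsII, (2.51) p.232] -/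
theorem sum_fiber_kernel_le_of_transposePair (σ : FBondY i → g.Site) (σI : IBondY i → g.Site) (U₁ : B.Cfg)
    (hc : 0 < cR39 b) {T' : (XBK κ i → ℝ) →ₗ[ℝ] (XHK κ i → ℝ)} (hT : IsTransposePair (HcoK i b B cfg O U₁) T')
    {K' : g.Site → g.Site → ℝ} (hK'0 : ∀ y y', 0 ≤ K' y y')
    (hK' : HasMajorantHom (g := toB6 g R₀ H₀) (fun p : XBK κ i => σ p.1) (fun p : XHK κ i => σI p.1) T' K')
    (c : IBondY i) (y' : g.Site) :
    ∑ z ∈ Finset.univ.filter (fun z => σ z = y'), (coordBound39 b * ∑ k', ‖O (cfg U₁) (deltaY c (b k')) z‖) ≤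
      (coordBound39 b * Fintype.card κ) * (basisBound39 b * ((cR39 b)⁻¹ * ((d + 1) * Fintype.card κ * K' (σI c) y'))) := by
  -- per basis direction `b_{k′}`: the column block sum of `‖O(δ_c ⊗ b_{k′})(·)‖` is a sub-sum of the fibre sum of `|HcoK v|`, `v` = the diagonal
  -- evaluation of the indicator of `c`, divided by `cR39`; that fibre sum is bounded by §1
  have hk : ∀ k', ∑ z ∈ Finset.univ.filter (fun z => σ z = y'), ‖O (cfg U₁) (deltaY c (b k')) z‖ ≤
      basisBound39 b * ((cR39 b)⁻¹ * ((d + 1) * Fintype.card κ * K' (σI c) y')) := by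
    intro k'
    have hentry : ∀ p : XBK κ i, HcoK i b B cfg O U₁ (evDiagK (indY i c)) p =
        cR39 b * b.repr (O (cfg U₁) (deltaY c (b p.2.2.2)) p.1) p.2.2.1 := by
      intro p
      rw [HcoK, LinearMap.smul_apply, Pi.smul_apply, coordOpKH_evDiagK, smul_eq_mul, LinearMap.restrictScalars_apply, liftY_indY]
    have hcol : ∑ p ∈ Finset.univ.filter (fun p : XBK κ i => σ p.1 = y'), |HcoK i b B cfg O U₁ (evDiagK (indY i c)) p| ≤
        (d + 1) * Fintype.card κ * K' (σI c) y' := by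
      have h := sum_fiber_abs_apply_le_of_transposePair (G := toB6 g R₀ H₀) (HcoK i b B cfg O U₁) T' hT (fun p : XBK κ i => σ p.1)
        (fun p : XHK κ i => σI p.1) hK' (evDiagK (indY i c)) y'
      refine h.trans ?_
      have hsupp : ∀ j : XHK κ i, |evDiagK (κ := κ) (D := Fin (d + 1)) (indY i c) j| * K' (σI j.1) y' ≤
          |evDiagK (κ := κ) (D := Fin (d + 1)) (indY i c) j| * K' (σI c) y' := by
        intro j
        by_cases hj : j.1 = c
        · rw [hj]
        · rw [evDiagK_eq_zero_of (indY_of_ne i hj), abs_zero, zero_mul, zero_mul]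
      calc ∑ j, |evDiagK (κ := κ) (D := Fin (d + 1)) (indY i c) j| * K' (σI j.1) y'
          ≤ ∑ j, |evDiagK (κ := κ) (D := Fin (d + 1)) (indY i c) j| * K' (σI c) y' := Finset.sum_le_sum fun j _ => hsupp j
        _ = (∑ j, |evDiagK (κ := κ) (D := Fin (d + 1)) (indY i c) j|) * K' (σI c) y' := by rw [Finset.sum_mul]
        _ ≤ (d + 1) * Fintype.card κ * K' (σI c) y' := mul_le_mul_of_nonneg_right (sum_abs_evDiagK_indY_le i c) (hK'0 _ _)
    have hz : ∀ z, ‖O (cfg U₁) (deltaY c (b k')) z‖ ≤ basisBound39 b * ∑ k, |b.repr (O (cfg U₁) (deltaY c (b k')) z) k| := fun z =>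
      norm_le_basisBound_mul b _ fun k => Finset.single_le_sum (f := fun k => |b.repr (O (cfg U₁) (deltaY c (b k')) z) k|)
        (fun _ _ => abs_nonneg _) (Finset.mem_univ k)
    refine (Finset.sum_le_sum fun z _ => hz z).trans ?_
    rw [← Finset.mul_sum]
    refine mul_le_mul_of_nonneg_left ?_ (Finset.sum_nonneg fun _ _ => norm_nonneg _)
    have hsub : ∑ z ∈ Finset.univ.filter (fun z => σ z = y'), ∑ k, |b.repr (O (cfg U₁) (deltaY c (b k')) z) k| =
        (cR39 b)⁻¹ * ∑ z ∈ Finset.univ.filter (fun z => σ z = y'), ∑ k,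
          |HcoK i b B cfg O U₁ (evDiagK (indY i c)) (z, (⟨0, hd⟩ : Fin (d + 1)), k, k')| := by
      rw [Finset.mul_sum]
      refine Finset.sum_congr rfl fun z _ => ?_
      rw [Finset.mul_sum]
      refine Finset.sum_congr rfl fun k _ => ?_
      rw [hentry, abs_mul, abs_of_pos hc, ← mul_assoc, inv_mul_cancel₀ hc.ne', one_mul]
    rw [hsub]
    refine mul_le_mul_of_nonneg_left (le_trans ?_ hcol) (inv_nonneg.mpr hc.le)
    rw [← Finset.sum_product']
    have hinj : ∑ zk ∈ (Finset.univ.filter (fun z => σ z = y')) ×ˢ (Finset.univ : Finset κ),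
        |HcoK i b B cfg O U₁ (evDiagK (indY i c)) (zk.1, (⟨0, hd⟩ : Fin (d + 1)), zk.2, k')| =
        ∑ p ∈ ((Finset.univ.filter (fun z => σ z = y')) ×ˢ (Finset.univ : Finset κ)).image
          (fun zk : FBondY i × κ => ((zk.1, (⟨0, hd⟩ : Fin (d + 1)), zk.2, k') : XBK κ i)), |HcoK i b B cfg O U₁ (evDiagK (indY i c)) p| := by
      rw [Finset.sum_image]
      rintro ⟨z₁, k₁⟩ _ ⟨z₂, k₂⟩ _ h
      simp only [Prod.mk.injEq] at h
      obtain ⟨h1, -, h3, -⟩ := h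
      rw [h1, h3]
    rw [hinj]
    refine Finset.sum_le_sum_of_subset_of_nonneg ?_ (fun _ _ _ => abs_nonneg _)
    intro p hp
    rw [Finset.mem_image] at hp
    obtain ⟨zk, hzk, rfl⟩ := hp
    rw [Finset.mem_product] at hzk
    exact Finset.mem_filter.2 ⟨Finset.mem_univ _, (Finset.mem_filter.1 hzk.1).2⟩
  have hcb : 0 ≤ coordBound39 b := norm_nonneg _
  calc ∑ z ∈ Finset.univ.filter (fun z => σ z = y'), (coordBound39 b * ∑ k', ‖O (cfg U₁) (deltaY c (b k')) z‖)
      = coordBound39 b * ∑ k', ∑ z ∈ Finset.univ.filter (fun z => σ z = y'), ‖O (cfg U₁) (deltaY c (b k')) z‖ := by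
        rw [← Finset.mul_sum, Finset.sum_comm]
    _ ≤ coordBound39 b * ∑ k' : κ, basisBound39 b * ((cR39 b)⁻¹ * ((d + 1) * Fintype.card κ * K' (σI c) y')) :=
        mul_le_mul_of_nonneg_left (Finset.sum_le_sum fun k' _ => hk k') hcb
    _ = (coordBound39 b * Fintype.card κ) * (basisBound39 b * ((cR39 b)⁻¹ * ((d + 1) * Fintype.card κ * K' (σI c) y'))) := by
        rw [Finset.sum_const, nsmul_eq_mul, Finset.card_univ]; ring

omit [CompleteSpace 𝔸] [DecidableEq κ] in
/-- the constant of §2 IS `(d+1)·#κ`: `coordBound39 b·#κ·basisBound39 b = cR39 b`. [cite: Balaban1985BackgroundPropagators, (3.48) p.398, bookkeeping] -/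
theorem colConst_eq (hc : 0 < cR39 b) (K : ℝ) :
    (coordBound39 b * Fintype.card κ) * (basisBound39 b * ((cR39 b)⁻¹ * ((d + 1) * Fintype.card κ * K))) = (d + 1) * Fintype.card κ * K := by
  have h : coordBound39 b * basisBound39 b * Fintype.card κ = cR39 b := rfl
  field_simp
  rw [← h]; ring


open Classical in
/-- ★★ **THE COLUMN-BLOCK KERNEL LETTER OF AN H-LETTER FROM A TRANSPOSE MAJORANT OF ITS MODEL**: if the scaled coordinate model `HcoK i b B cfg O U₁` of
`O(U) : (coarse → 𝔸) →ₗ (fine → 𝔸)` has a counting-transpose `T′` with the [4]-(2.51) two-space majorant `K′` from the fine carrier (block map `σ ∘ fst`)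
to the coarse carrier (block map `σ_I ∘ fst`), then for every coarse point `c`, every fine block `y′` and every `a`:
`Σ_{z : σ z = y′} ‖O(U)(δ_c ⊗ a)(z)‖ ≦ (d+1)·#κ·K′(σ_I c, y′)·‖a‖` — the SUM-OVER-THE-BLOCK twin of F5 §5's pointwise letter
`norm_apply_deltaY_le_of_hasMajorantHom`; it is what the fine sum in `(H†J)(c)` consumes (print pays it with the `η^d` of the weighted scalar product).
[cite: Balaban1985BackgroundPropagators, (3.133) p.422, (3.126) p.420, (3.136) p.422; Balaban1984PropagatorsII, (2.51) p.232] -/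
theorem sum_fiber_norm_apply_deltaY_le_of_transposePair (σ : FBondY i → g.Site) (σI : IBondY i → g.Site) (U₁ : B.Cfg)
    (hc : 0 < cR39 b) {T' : (XBK κ i → ℝ) →ₗ[ℝ] (XHK κ i → ℝ)} (hT : IsTransposePair (HcoK i b B cfg O U₁) T')
    {K' : g.Site → g.Site → ℝ} (hK'0 : ∀ y y', 0 ≤ K' y y')
    (hK' : HasMajorantHom (g := toB6 g R₀ H₀) (fun p : XBK κ i => σ p.1) (fun p : XHK κ i => σI p.1) T' K')
    (a : 𝔸) (c : IBondY i) (y' : g.Site) :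
    ∑ z ∈ Finset.univ.filter (fun z => σ z = y'), ‖O (cfg U₁) (deltaY c a) z‖ ≤ (d + 1) * Fintype.card κ * K' (σI c) y' * ‖a‖ := by
  have h1 := sum_fiber_kernel_le_of_transposePair (R₀ := R₀) (H₀ := H₀) i b B cfg O σ σI U₁ hc hT hK'0 hK' c y'
  rw [colConst_eq b hc] at h1
  calc ∑ z ∈ Finset.univ.filter (fun z => σ z = y'), ‖O (cfg U₁) (deltaY c a) z‖
      ≤ ∑ z ∈ Finset.univ.filter (fun z => σ z = y'), (coordBound39 b * ∑ k', ‖O (cfg U₁) (deltaY c (b k')) z‖) * ‖a‖ :=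
        Finset.sum_le_sum fun z _ => norm_apply_deltaY_le_sum_basis i b O (cfg U₁) a c z
    _ = (∑ z ∈ Finset.univ.filter (fun z => σ z = y'), (coordBound39 b * ∑ k', ‖O (cfg U₁) (deltaY c (b k')) z‖)) * ‖a‖ := by
        rw [Finset.sum_mul]
    _ ≤ (d + 1) * Fintype.card κ * K' (σI c) y' * ‖a‖ := mul_le_mul_of_nonneg_right h1 (norm_nonneg _)

end Column

/-! ## §3 The `(H†J)(c)` letter from a pointwise kernel letter with column-block sums and a block-shaped current letter -/

section Fibrewise

variable {X B : Type} [Fintype X] [Fintype B]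

open Classical in
/-- regrouping a fine sum by blocks under a column-block letter: `Σ_z K_H(z)·w(σ z) ≦ Σ_y k(y)·w(y)` once `Σ_{z ∈ Δ(y)} K_H(z) ≦ k(y)` and `w ≧ 0`.
[cite: Balaban1984PropagatorsII, (2.51)–(2.52) p.232, bookkeeping] -/
theorem sum_mul_weight_fiberwise_le (σ : X → B) {KH : X → ℝ} {k w : B → ℝ} (hw : ∀ y, 0 ≤ w y)
    (hcol : ∀ y, ∑ z ∈ Finset.univ.filter (fun z => σ z = y), KH z ≤ k y) :
    ∑ z, KH z * w (σ z) ≤ ∑ y, k y * w y := by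
  rw [← Finset.sum_fiberwise_of_maps_to (g := σ) (t := Finset.univ) (fun z _ => Finset.mem_univ (σ z))]
  refine Finset.sum_le_sum fun y _ => ?_
  have h : ∑ z ∈ Finset.univ.filter (fun z => σ z = y), KH z * w (σ z) = (∑ z ∈ Finset.univ.filter (fun z => σ z = y), KH z) * w y := by
    rw [Finset.sum_mul]
    exact Finset.sum_congr rfl fun z hz => by rw [(Finset.mem_filter.1 hz).2]
  rw [h]
  exact mul_le_mul_of_nonneg_right (hcol y) (hw y)

end Fibrewise

section HJ

variable {N : ℕ} {X Y B : Type} [Fintype X] [Fintype Y] [Fintype B]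

open Classical in
/-- ★★ **`‖(H†J)(c)‖` FROM A POINTWISE KERNEL LETTER WITH COLUMN-BLOCK SUMS AND A BLOCK-SHAPED CURRENT LETTER**: for ANY `ℂ`-linear `H : (Y → M_N) →ₗ (X → M_N)`
with `‖H(δ_c ⊗ a)(z)‖ ≦ K_H(z)‖a‖`, column-block sums `Σ_{z ∈ Δ(y)} K_H(z) ≦ k(y)` (block map `σ`) and a current with `‖J(z)‖ ≦ t_J·w_J(σ z)`:
`‖(H†J)(c)‖ ≦ N·𝔟²·t_J·Σ_y k(y)·w_J(y)` (`𝔟 = basisBound39 (trBasis N)`; F5 §4 `norm_trAdjY_apply_le` + regrouping).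
[cite: Balaban1985BackgroundPropagators, (3.136) p.422 («(H\*J)(b)»), p.422 («we have the estimate |(H\*J)(b)| ≦ …»); Balaban1984PropagatorsII, (2.51) p.232] -/
theorem norm_trAdjY_apply_le_cols (σ : X → B) (H : (Y → Matrix (Fin N) (Fin N) ℂ) →ₗ[ℂ] (X → Matrix (Fin N) (Fin N) ℂ))
    (J : X → Matrix (Fin N) (Fin N) ℂ) (c : Y) {KH : X → ℝ} {k wJ : B → ℝ} {tJ : ℝ} (hKH : ∀ z, 0 ≤ KH z) (htJ : 0 ≤ tJ)
    (hwJ : ∀ y, 0 ≤ wJ y) (hH : ∀ (a : Matrix (Fin N) (Fin N) ℂ) (z : X), ‖H (deltaY c a) z‖ ≤ KH z * ‖a‖)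
    (hcol : ∀ y, ∑ z ∈ Finset.univ.filter (fun z => σ z = y), KH z ≤ k y) (hJ : ∀ z, ‖J z‖ ≤ tJ * wJ (σ z)) :
    ‖trAdjY (trDualMatY N) H J c‖ ≤ N * basisBound39 (trBasis N) ^ 2 * tJ * ∑ y, k y * wJ y := by
  have h := norm_trAdjY_apply_le H J c hKH hH hJ
  have hre : ∑ z, KH z * (tJ * wJ (σ z)) = tJ * ∑ z, KH z * wJ (σ z) := by
    rw [Finset.mul_sum]; exact Finset.sum_congr rfl fun z _ => by ring
  have hfib : ∑ z, KH z * wJ (σ z) ≤ ∑ y, k y * wJ y := sum_mul_weight_fiberwise_le σ hwJ hcol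
  have hpre : 0 ≤ (N : ℝ) * basisBound39 (trBasis N) ^ 2 := mul_nonneg (Nat.cast_nonneg N) (sq_nonneg _)
  calc ‖trAdjY (trDualMatY N) H J c‖ ≤ N * basisBound39 (trBasis N) ^ 2 * ∑ z, KH z * (tJ * wJ (σ z)) := h
    _ = N * basisBound39 (trBasis N) ^ 2 * (tJ * ∑ z, KH z * wJ (σ z)) := by rw [hre]
    _ ≤ N * basisBound39 (trBasis N) ^ 2 * (tJ * ∑ y, k y * wJ y) :=
        mul_le_mul_of_nonneg_left (mul_le_mul_of_nonneg_left hfib htJ) hpre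
    _ = N * basisBound39 (trBasis N) ^ 2 * tJ * ∑ y, k y * wJ y := by ring

end HJ

/-! ## §4 The «O(1)» geometric sum: one scale transfer and one row sum; the p. 398 transfer at any exponent under the explicit size condition -/

section Sum

variable {g : B9.Geometry} [Fintype g.Site]

/-- ★ **THE «O(1)» SUM**: `Σ_{y′} e^{−δ d(c,y′)}·W(y′) ≦ C_T·c_R·W(c)` whenever the weight transfers at rate `ρ_T` (`e^{−ρ_T d(y,y′)}W(y′) ≦ C_T·W(y)`, the
p. 398 scale transfer ∕ [4] (2.60)), the row sum at rate `ρ_R` is `≦ c_R` ([4] (2.61)) and `ρ_T + ρ_R ≦ δ`.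
[cite: Balaban1985BackgroundPropagators, p.398 (remark after (3.47)), p.422; Balaban1984PropagatorsII, Lemma 2.1 (2.60)–(2.61) pp.233–234] -/
theorem sum_exp_mul_weight_le {δ ρT ρR CT cR : ℝ} {W : g.Site → ℝ} (hW : ∀ y, 0 ≤ W y) (hCT : 0 ≤ CT)
    (hδ : ρT + ρR ≤ δ) (hdist : ∀ y y', 0 ≤ g.dist y y') (hT : ∀ y y', Real.exp (-(ρT * g.dist y y')) * W y' ≤ CT * W y)
    (c : g.Site) (hR : ∑ y', Real.exp (-(ρR * g.dist c y')) ≤ cR) :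
    ∑ y', Real.exp (-(δ * g.dist c y')) * W y' ≤ CT * cR * W c := by
  have hcR : 0 ≤ cR := le_trans (Finset.sum_nonneg fun _ _ => Real.exp_nonneg _) hR
  calc ∑ y', Real.exp (-(δ * g.dist c y')) * W y'
      ≤ ∑ y', Real.exp (-(ρR * g.dist c y')) * (Real.exp (-(ρT * g.dist c y')) * W y') := by
        refine Finset.sum_le_sum fun y' _ => ?_
        rw [← mul_assoc, ← Real.exp_add]
        refine mul_le_mul_of_nonneg_right (Real.exp_le_exp.2 ?_) (hW y')
        nlinarith [hdist c y']
    _ ≤ ∑ y', Real.exp (-(ρR * g.dist c y')) * (CT * W c) :=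
        Finset.sum_le_sum fun y' _ => mul_le_mul_of_nonneg_left (hT c y') (Real.exp_nonneg _)
    _ = (∑ y', Real.exp (-(ρR * g.dist c y'))) * (CT * W c) := by rw [Finset.sum_mul]
    _ ≤ cR * (CT * W c) := mul_le_mul_of_nonneg_right hR (mul_nonneg hCT (hW c))
    _ = CT * cR * W c := by ring

/-- ★ **THE p. 398 SCALE TRANSFER FOR `(Lʲη)^γ` AT ANY EXPONENT `γ` UNDER THE EXPLICIT SIZE CONDITION `|γ|·log L ≦ αδRM`**:
`e^{−αδ d(y,y′)}(L^{j′}η)^γ ≦ L^{|γ|}(Lʲη)^γ` (`B9Ineq347.ScaleTransfer`), from [4] (2.60) (`Ineq260` at the exponent `α`) by the engine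
`B9Ineq347.scaleTransfer_of_260` — F5's `B9RWSums346Schur.scaleTransfer_len_rpow` is the case `|γ| ≦ 4` (size condition from `Facts347.size`); block-count
exponents `γ = ±(d+1)` need this form (above a `γ`-dependent `M`-threshold). [cite: Balaban1985BackgroundPropagators, p.398 remark after (3.47); Balaban1984PropagatorsII, Lemma 2.1 (2.59)–(2.60) pp.233–234] -/
theorem scaleTransfer_len_rpow_of_size {R : ℝ} {H : Prop} {δ α : ℝ} (h260 : Ineq260 (toB6 g R H) δ α) (hL : 1 ≤ g.L) (hη : 0 < g.eta)
    (γ : ℝ) (hsz : |γ| * Real.log g.L ≤ α * δ * R * g.M) :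
    ScaleTransfer g δ α (g.L ^ |γ|) (fun y => g.len y ^ γ) := by
  have hL0 : 0 < g.L := lt_of_lt_of_le one_pos hL
  exact scaleTransfer_of_260 g δ α (Real.exp (-(α * δ * R * g.M))) (g.L ^ |γ|) (fun y => g.len y ^ γ)
    (fun y y' => Nat.dist (g.scale y) (g.scale y')) (Real.exp_nonneg _) (Real.one_le_rpow hL (abs_nonneg γ))
    (rpow_abs_mul_exp_le_one g.L γ _ hL0 hsz) (weight_nonneg g hL0 hη γ)
    (h260_nat_of_Ineq260 g R H δ α h260) (fun y y' => weight_ratio g hL hη γ y y')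

end Sum

/-! ## §5 THE PRINTED SENTENCE: `‖(H†J(U))(c)‖ ≦ O(1)·C·(Lʲη)⁻³` for def-Y's genuine current under `RegularAt` everywhere and the column-block kernel letter -/

section Printed

open B9Eq336CurrentBound (RegularAt)
open B9BackgroundsKLevelV1 (shiftsV1)
open B6GlobalChartV1 (PV)

variable {d ℓ : ℕ} {hd : 1 ≤ d + 1} {hL : Odd (ℓ + 1) ∧ 1 < ℓ + 1} {b₀ b₁ : ℝ} {N : ℕ}
variable (i : KIdx d ℓ hd hL b₀ b₁) {g : B9.Geometry} [Fintype g.Site]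

open Classical in
/-- ★★★ **THE PRINTED SENTENCE (p. 422): `|(H\*J)(b)| ≦ O(1)Mα₀(Lʲη)⁻³, b ∈ Λ_j`**, in the tree's currency.  For ANY `ℂ`-linear
`H : (coarse → M_N) →ₗ (fine → M_N)` (e.g. def-Y's `HDY i parS parB Gp U` at any site propagator) and def-Y's genuine current `J(U) = JY i U`: if
(i) `H` has the pointwise kernel letter `‖H(δ_c ⊗ a)(z)‖ ≦ K_H(z)‖a‖` whose COLUMN-BLOCK SUMS over the fine blocks `Δ(y′) = {z : σ_I (bI z) = y′}` are
`≦ B_H·e^{−δ_H d(σ_I c, y′)}` ((3.133)'s content in column form — e.g. §2 from a transpose majorant of the model `HcoK`), (ii) the background is REGULAR at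
every fine bond at the scale of the block its source is pinned to (r06's bond-local datum `RegularAt` of (3.35)–(3.36), constant `0 ≦ C ≦ 1` = print's
`O(1)Mα₀`; direction-blind pin `hbI0`; every block scale `≧ η`), (iii) the weight `(len)⁻³` transfers at rate `ρ_T` with constant `C_T` and the row sum at
rate `ρ_R` is `≦ c_R`, `ρ_T + ρ_R ≦ δ_H` — then
`‖(H†J(U))(c)‖ ≦ N·𝔟²·(10⁴(d+1)C)·B_H·C_T·c_R·(len (σ_I c))⁻³`.
[cite: Balaban1985BackgroundPropagators, p.422 (the sentence between (3.136) and (3.137)), (3.36) p.396, (3.133) p.422, (3.11) p.392, p.398; Balaban1984PropagatorsII, (2.51) p.232, Lemma 2.1 (2.60)–(2.61) pp.233–234] -/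
theorem norm_trAdjY_JY_le_of_cols_regularAt
    (H : (IBondY i → Matrix (Fin N) (Fin N) ℂ) →ₗ[ℂ] (FBondY i → Matrix (Fin N) (Fin N) ℂ))
    (bI : FBondY i → IBondY i) (hbI0 : ∀ f : FBondY i, bI f = bI ⟨f.src, 0⟩) (σI : IBondY i → g.Site)
    (hlen : ∀ y : g.Site, etaBY i ≤ g.len y) {C : ℝ} (hC0 : 0 ≤ C) (hC1 : C ≤ 1) (U : CfgY (Matrix (Fin N) (Fin N) ℂ) i)
    (hreg : ∀ μ s, RegularAt (shiftsV1 (PV d ℓ i.m i.K hd hL)) U (etaBY i) C (g.len (σI (bI ⟨s, 0⟩))) μ s)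
    (c : IBondY i) {KH : FBondY i → ℝ} {BH δH : ℝ} (hKH : ∀ z, 0 ≤ KH z) (hBH : 0 ≤ BH)
    (hH : ∀ (a : Matrix (Fin N) (Fin N) ℂ) (z : FBondY i), ‖H (deltaY c a) z‖ ≤ KH z * ‖a‖)
    (hcol : ∀ y', ∑ z ∈ Finset.univ.filter (fun z => σI (bI z) = y'), KH z ≤ BH * Real.exp (-(δH * g.dist (σI c) y')))
    {ρT ρR CT cR : ℝ} (hCT : 0 ≤ CT) (hδ : ρT + ρR ≤ δH) (hdist : ∀ y y', 0 ≤ g.dist y y')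
    (hT : ∀ y y', Real.exp (-(ρT * g.dist y y')) * (g.len y' ^ 3)⁻¹ ≤ CT * (g.len y ^ 3)⁻¹)
    (hR : ∑ y', Real.exp (-(ρR * g.dist (σI c) y')) ≤ cR) :
    ‖trAdjY (trDualMatY N) H (JY i U) c‖ ≤
      N * basisBound39 (trBasis N) ^ 2 * (10 ^ 4 * (d + 1) * C) * (BH * (CT * cR * (g.len (σI c) ^ 3)⁻¹)) := by
  have hlen0 : ∀ y : g.Site, 0 < g.len y := fun y => (etaBY_pos i).trans_le (hlen y)
  -- (3.36) ⟹ the current letter, r06 by name, at the site pin `s ↦ σ_I (bI ⟨s, 0⟩)`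
  have hJ : ∀ z : FBondY i, ‖JY i U z‖ ≤ 10 ^ 4 * (d + 1) * C * (g.len (σI (bI z)) ^ 3)⁻¹ := by
    intro z
    have h := norm_JY_le_of_regularAt (𝔸 := Matrix (Fin N) (Fin N) ℂ) i (fun s => σI (bI ⟨s, 0⟩)) g.len hlen hC0 hC1 U hreg z
    rw [← hbI0 z] at h
    exact h
  have htJ : (0 : ℝ) ≤ 10 ^ 4 * (d + 1) * C := by positivity
  have h := norm_trAdjY_apply_le_cols (fun z => σI (bI z)) H (JY i U) c (k := fun y' => BH * Real.exp (-(δH * g.dist (σI c) y')))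
    (wJ := fun y' => (g.len y' ^ 3)⁻¹) hKH htJ (fun y => inv_nonneg.mpr (pow_nonneg (hlen0 y).le 3)) hH hcol hJ
  have hsum : ∑ y', BH * Real.exp (-(δH * g.dist (σI c) y')) * (g.len y' ^ 3)⁻¹ ≤ BH * (CT * cR * (g.len (σI c) ^ 3)⁻¹) := by
    have hs := sum_exp_mul_weight_le (W := fun y' => (g.len y' ^ 3)⁻¹) (fun y => inv_nonneg.mpr (pow_nonneg (hlen0 y).le 3)) hCT hδ
      hdist hT (σI c) hR
    calc ∑ y', BH * Real.exp (-(δH * g.dist (σI c) y')) * (g.len y' ^ 3)⁻¹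
        = BH * ∑ y', Real.exp (-(δH * g.dist (σI c) y')) * (g.len y' ^ 3)⁻¹ := by
          rw [Finset.mul_sum]; exact Finset.sum_congr rfl fun y' _ => by ring
      _ ≤ BH * (CT * cR * (g.len (σI c) ^ 3)⁻¹) := mul_le_mul_of_nonneg_left hs hBH
  have hpre : 0 ≤ (N : ℝ) * basisBound39 (trBasis N) ^ 2 * (10 ^ 4 * (d + 1) * C) := mul_nonneg (mul_nonneg (Nat.cast_nonneg N) (sq_nonneg _)) htJ
  exact h.trans (mul_le_mul_of_nonneg_left hsum hpre)

open Classical in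
/-- ★★★ **THE PRINTED SENTENCE FROM A TRANSPOSE MAJORANT** (one-call form of `norm_trAdjY_JY_le_of_cols_regularAt` ∘ §2): for an H-letter
`O(U) : (coarse → M_N(ℂ)) →ₗ (fine → M_N(ℂ))` read through n06-d's scaled coordinate model `HcoK i (trBasis N) B cfg O U₁` — if that model has a
counting-transpose `T′` with the [4]-(2.51) majorant `B_T·e^{−δ_T d}` from the fine carrier (blocks `σ_I ∘ bI ∘ fst`) to the coarse one (blocks `σ_I ∘ fst`),
the background `cfg U₁` is REGULAR at every fine bond at the scale of its pinned block (`RegularAt`, `0 ≦ C ≦ 1`), the weight `(len)⁻³` transfers and the row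
sum is bounded (`ρ_T + ρ_R ≦ δ_T`) — then `‖(O(U)†J(U))(c)‖ ≦ N·𝔟²·(10⁴(d+1)C)·((d+1)·#κ·B_T)·C_T·c_R·(len (σ_I c))⁻³`, `κ = TrIdx N`.
[cite: Balaban1985BackgroundPropagators, p.422 (the sentence between (3.136) and (3.137)), (3.133) p.422, (3.36) p.396, (3.126) p.420, p.398; Balaban1984PropagatorsII, (2.51) p.232, Lemma 2.1 (2.60)–(2.61) pp.233–234] -/
theorem norm_trAdjY_JY_le_of_transposePair_regularAt {R₀ : ℝ} {H₀ : Prop} (B : B9.Backgrounds) (cfg : B.Cfg → CfgY (Matrix (Fin N) (Fin N) ℂ) i)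
    (O : CfgY (Matrix (Fin N) (Fin N) ℂ) i → (IBondY i → Matrix (Fin N) (Fin N) ℂ) →ₗ[ℂ] (FBondY i → Matrix (Fin N) (Fin N) ℂ)) (U₁ : B.Cfg)
    (bI : FBondY i → IBondY i) (hbI0 : ∀ f : FBondY i, bI f = bI ⟨f.src, 0⟩) (σI : IBondY i → g.Site)
    (hlen : ∀ y : g.Site, etaBY i ≤ g.len y) {C : ℝ} (hC0 : 0 ≤ C) (hC1 : C ≤ 1)
    (hreg : ∀ μ s, RegularAt (shiftsV1 (PV d ℓ i.m i.K hd hL)) (cfg U₁) (etaBY i) C (g.len (σI (bI ⟨s, 0⟩))) μ s)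
    (hc : 0 < cR39 (trBasis N)) {T' : (XBK (TrIdx N) i → ℝ) →ₗ[ℝ] (XHK (TrIdx N) i → ℝ)}
    (hT : IsTransposePair (HcoK i (trBasis N) B cfg O U₁) T') {BT δT : ℝ} (hBT : 0 ≤ BT)
    (hK' : HasMajorantHom (g := toB6 g R₀ H₀) (fun p : XBK (TrIdx N) i => σI (bI p.1)) (fun p : XHK (TrIdx N) i => σI p.1) T'
      (fun a y' => BT * Real.exp (-(δT * g.dist a y'))))
    (c : IBondY i) {ρT ρR CT cR : ℝ} (hCT : 0 ≤ CT) (hδ : ρT + ρR ≤ δT) (hdist : ∀ y y', 0 ≤ g.dist y y')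
    (htr : ∀ y y', Real.exp (-(ρT * g.dist y y')) * (g.len y' ^ 3)⁻¹ ≤ CT * (g.len y ^ 3)⁻¹)
    (hR : ∑ y', Real.exp (-(ρR * g.dist (σI c) y')) ≤ cR) :
    ‖trAdjY (trDualMatY N) (O (cfg U₁)) (JY i (cfg U₁)) c‖ ≤
      N * basisBound39 (trBasis N) ^ 2 * (10 ^ 4 * (d + 1) * C) *
        (((d + 1) * Fintype.card (TrIdx N) * BT) * (CT * cR * (g.len (σI c) ^ 3)⁻¹)) := by
  have hKH0 : ∀ z : FBondY i, 0 ≤ coordBound39 (trBasis N) * ∑ k', ‖O (cfg U₁) (deltaY c (trBasis N k')) z‖ := fun z =>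
    mul_nonneg (norm_nonneg _) (Finset.sum_nonneg fun _ _ => norm_nonneg _)
  have hH : ∀ (a : Matrix (Fin N) (Fin N) ℂ) (z : FBondY i),
      ‖O (cfg U₁) (deltaY c a) z‖ ≤ (coordBound39 (trBasis N) * ∑ k', ‖O (cfg U₁) (deltaY c (trBasis N k')) z‖) * ‖a‖ :=
    fun a z => norm_apply_deltaY_le_sum_basis i (trBasis N) O (cfg U₁) a c z
  have hcol : ∀ y', ∑ z ∈ Finset.univ.filter (fun z => σI (bI z) = y'), (coordBound39 (trBasis N) * ∑ k', ‖O (cfg U₁) (deltaY c (trBasis N k')) z‖) ≤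
      ((d + 1) * Fintype.card (TrIdx N) * BT) * Real.exp (-(δT * g.dist (σI c) y')) := by
    intro y'
    have h := sum_fiber_kernel_le_of_transposePair (R₀ := R₀) (H₀ := H₀) i (trBasis N) B cfg O (fun z => σI (bI z)) σI U₁ hc hT
      (fun _ _ => mul_nonneg hBT (Real.exp_nonneg _)) hK' c y'
    rw [colConst_eq (trBasis N) hc] at h
    refine h.trans (le_of_eq ?_)
    ring
  exact norm_trAdjY_JY_le_of_cols_regularAt i (O (cfg U₁)) bI hbI0 σI hlen hC0 hC1 (cfg U₁) hreg c hKH0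
    (mul_nonneg (mul_nonneg (by positivity) (Nat.cast_nonneg _)) hBT) hH hcol hCT hδ hdist htr hR

end Printed

/-! ## §6 (v1.1, APPEND-ONLY) THE WEIGHTED TRANSPOSE LETTER — the member-uniformly inhabitable form.  At the N06 record the flat `C = (QGQ\*)⁻¹` has
entries `≍ n_b·(Lʲη)_b⁻²` (dag-n06-h «C-LETTER-FLAT-AT-ONE», node00-def-Y (W2): the tree's `Q\*` is print's divided by the block count
`n_b = L^{(d+1)j(b)}`), so the counting-transpose `T′ = C ∘ Q ∘ G_D` of the H-model has the [4]-(2.51) majorant `B_T·n_c·e^{−δ_T d(c, y′)}` with a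
member-uniform `B_T` only AFTER a weight `W_T(c)` at the COARSE end — §5's constant-`B_T` form is the case `W_T ≡ 1` (bounded-level members).  The weight
travels into the current letter, `w_H(c) = W_T(c)·(Lʲη)_c⁻³`, and is print's `η^{−d}(Lʲη)^{d+1}` volume factor between the tree's unweighted `H†` and print's
`H\*` (F5's module docstring); [5]'s form letter carries its inverse. -/

section Weighted

open B9Eq336CurrentBound (RegularAt)
open B9BackgroundsKLevelV1 (shiftsV1)
open B6GlobalChartV1 (PV)

variable {d ℓ : ℕ} {hd : 1 ≤ d + 1} {hL : Odd (ℓ + 1) ∧ 1 < ℓ + 1} {b₀ b₁ : ℝ} {N : ℕ}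
variable (i : KIdx d ℓ hd hL b₀ b₁) {g : B9.Geometry} [Fintype g.Site]

open Classical in
/-- ★★★ **THE PRINTED SENTENCE FROM A WEIGHTED TRANSPOSE MAJORANT** (v1.1; `norm_trAdjY_JY_le_of_transposePair_regularAt` is the case `W_T ≡ 1`): if the
counting-transpose `T′` of the model `HcoK i (trBasis N) B cfg O U₁` has the [4]-(2.51) majorant `B_T·W_T(a)·e^{−δ_T d(a, y′)}` with a WEIGHT `W_T ≧ 0` at the
coarse end (blocks `σ_I ∘ bI ∘ fst` → `σ_I ∘ fst`), the background is REGULAR at every fine bond (`RegularAt`, `0 ≦ C ≦ 1`), the weight `(len)⁻³` transfers and the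
row sum is bounded (`ρ_T + ρ_R ≦ δ_T`) — then `‖(O(U)†J(U))(c)‖ ≦ N·𝔟²·(10⁴(d+1)C)·((d+1)·#κ·B_T·W_T(σ_I c))·C_T·c_R·(len (σ_I c))⁻³`.
[cite: Balaban1985BackgroundPropagators, p.422 (the sentence between (3.136) and (3.137)), (3.133) p.422, (3.36) p.396, (3.126) p.420, p.398, p.391 (the weighted scalar products); Balaban1984PropagatorsII, (2.51) p.232, Lemma 2.1 (2.60)–(2.61) pp.233–234; Balaban1984PropagatorsI, (1.18) p.20] -/
theorem norm_trAdjY_JY_le_of_transposePair_regularAt_w {R₀ : ℝ} {H₀ : Prop} (B : B9.Backgrounds) (cfg : B.Cfg → CfgY (Matrix (Fin N) (Fin N) ℂ) i)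
    (O : CfgY (Matrix (Fin N) (Fin N) ℂ) i → (IBondY i → Matrix (Fin N) (Fin N) ℂ) →ₗ[ℂ] (FBondY i → Matrix (Fin N) (Fin N) ℂ)) (U₁ : B.Cfg)
    (bI : FBondY i → IBondY i) (hbI0 : ∀ f : FBondY i, bI f = bI ⟨f.src, 0⟩) (σI : IBondY i → g.Site)
    (hlen : ∀ y : g.Site, etaBY i ≤ g.len y) {C : ℝ} (hC0 : 0 ≤ C) (hC1 : C ≤ 1)
    (hreg : ∀ μ s, RegularAt (shiftsV1 (PV d ℓ i.m i.K hd hL)) (cfg U₁) (etaBY i) C (g.len (σI (bI ⟨s, 0⟩))) μ s)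
    (hc : 0 < cR39 (trBasis N)) {T' : (XBK (TrIdx N) i → ℝ) →ₗ[ℝ] (XHK (TrIdx N) i → ℝ)}
    (hT : IsTransposePair (HcoK i (trBasis N) B cfg O U₁) T') {BT δT : ℝ} (hBT : 0 ≤ BT) {WT : g.Site → ℝ} (hWT : ∀ a, 0 ≤ WT a)
    (hK' : HasMajorantHom (g := toB6 g R₀ H₀) (fun p : XBK (TrIdx N) i => σI (bI p.1)) (fun p : XHK (TrIdx N) i => σI p.1) T'
      (fun a y' => BT * WT a * Real.exp (-(δT * g.dist a y'))))
    (c : IBondY i) {ρT ρR CT cR : ℝ} (hCT : 0 ≤ CT) (hδ : ρT + ρR ≤ δT) (hdist : ∀ y y', 0 ≤ g.dist y y')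
    (htr : ∀ y y', Real.exp (-(ρT * g.dist y y')) * (g.len y' ^ 3)⁻¹ ≤ CT * (g.len y ^ 3)⁻¹)
    (hR : ∑ y', Real.exp (-(ρR * g.dist (σI c) y')) ≤ cR) :
    ‖trAdjY (trDualMatY N) (O (cfg U₁)) (JY i (cfg U₁)) c‖ ≤
      N * basisBound39 (trBasis N) ^ 2 * (10 ^ 4 * (d + 1) * C) *
        (((d + 1) * Fintype.card (TrIdx N) * BT * WT (σI c)) * (CT * cR * (g.len (σI c) ^ 3)⁻¹)) := by
  have hKH0 : ∀ z : FBondY i, 0 ≤ coordBound39 (trBasis N) * ∑ k', ‖O (cfg U₁) (deltaY c (trBasis N k')) z‖ := fun z =>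
    mul_nonneg (norm_nonneg _) (Finset.sum_nonneg fun _ _ => norm_nonneg _)
  have hH : ∀ (a : Matrix (Fin N) (Fin N) ℂ) (z : FBondY i),
      ‖O (cfg U₁) (deltaY c a) z‖ ≤ (coordBound39 (trBasis N) * ∑ k', ‖O (cfg U₁) (deltaY c (trBasis N k')) z‖) * ‖a‖ :=
    fun a z => norm_apply_deltaY_le_sum_basis i (trBasis N) O (cfg U₁) a c z
  have hcol : ∀ y', ∑ z ∈ Finset.univ.filter (fun z => σI (bI z) = y'), (coordBound39 (trBasis N) * ∑ k', ‖O (cfg U₁) (deltaY c (trBasis N k')) z‖) ≤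
      ((d + 1) * Fintype.card (TrIdx N) * BT * WT (σI c)) * Real.exp (-(δT * g.dist (σI c) y')) := by
    intro y'
    have h := sum_fiber_kernel_le_of_transposePair (R₀ := R₀) (H₀ := H₀) i (trBasis N) B cfg O (fun z => σI (bI z)) σI U₁ hc hT
      (fun a _ => mul_nonneg (mul_nonneg hBT (hWT a)) (Real.exp_nonneg _)) hK' c y'
    rw [colConst_eq (trBasis N) hc] at h
    refine h.trans (le_of_eq ?_)
    ring
  exact norm_trAdjY_JY_le_of_cols_regularAt i (O (cfg U₁)) bI hbI0 σI hlen hC0 hC1 (cfg U₁) hreg c hKH0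
    (mul_nonneg (mul_nonneg (mul_nonneg (by positivity) (Nat.cast_nonneg _)) hBT) (hWT _)) hH hcol hCT hδ hdist htr hR

end Weighted

end Literature.MathematicalPhysics.QuantumFieldTheory.Balaban1983to89.B9Eq3136HstarJBound

end
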